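import Literature.AlgebraicGeometry.Resolution.MonoidalTransformFrameStep
import Literature.AlgebraicGeometry.Resolution.MonoidalEFReductionTracked
import HarnessLib

/-!
# Principalizing the maximal ideal of a regular frame model by two monoidal transforms along `O`

Topic: `Literature/AlgebraicGeometry/Resolution` (proofs only; no new notions, no new named
facts). In [CoP1] Prop. 8.1 (V. Cossart, O. Piltant, J. Algebra 320 (2008), HAL hal-00139124,
p. 22) the pre-stage makes `m_{S₀} S₂` a monomial ideal (principalization of the ideal of the
centre, Cor. 4.6 / Prop. 4.1); in Cossart–Piltant 2019's descent (J. Algebra 529 (2019) =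
arXiv:1412.0868, proof of Prop. 4.8 with Lemma 4.7) the same is needed for the regular local
ring `S₀` at the centre of the extension `v̂`, with the extra requirement that the generator and
the new denominators be `K`-FINITE. For a REGULAR local ring of dimension `3` with regular
parameters `x₁, x₂, x₃` this is elementary: two monoidal transforms along `O` at `(x_a, x_b)` and
`(x_a, x_c)`, where `x_a` has the LEAST value, adjoin `x_b/x_a`, `x_c/x_a` and give a regular
model in which `𝔪 = (x_a)`; the only denominator is `x_a` (whose value is at most that of any
element of `𝔪`, hence `K`-finite in the descent).

* `exists_frameStep_le` — one monoidal transform at `(x_a, x_b)` with `v(x_b) ≥ v(x_a)` (either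
  case of `MonoidalTransformFrameStep.lean`), keeping `x_c`, `c ≠ b`, among the parameters;
* `exists_frameSteps_maximalIdeal_principal` — the two transforms: a regular model
  `S[t ∪ {x_b/x_a, x_c/x_a}]` containing `R_t`, in which every element of `𝔪_{R_t}` is `x_a`
  times an element of the new local ring.

## Sources

* V. Cossart, O. Piltant, J. Algebra 320 (2008) 1051–1082: proof of Prop. 8.1 (HAL
  hal-00139124, pp. 22–23). [CossartPiltant2008]
* V. Cossart, O. Piltant, J. Algebra 529 (2019) 268–535 = arXiv:1412.0868, proof of Prop. 4.8
  with Lemma 4.7 (arXiv v1: Prop. 4.6, p. 53). [CossartPiltant2019]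
-/

noncomputable section

namespace Literature.AlgebraicGeometry.Resolution

universe u

open IsLocalRing _root_.Polynomial Function

section Principalize

variable {S : Type u} [CommRing S] [IsDomain S] [IsLocalRing S] {E : Type u} [Field E]
  [Algebra S E] [Algebra.IsAlgebraic S E]
  (hSuc : IsUniversallyCatenaryRing S) (hinj : Function.Injective (algebraMap S E))
  (O : ValuationSubring E) (hSO : ∀ s : S, algebraMap S E s ∈ O)
  (hdom : ∀ s ∈ maximalIdeal S, O.valuation (algebraMap S E s) < 1)
  (hres : ∀ y : O, ∃ q : S[X], (∃ i, q.coeff i ∉ maximalIdeal S) ∧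
    O.valuation (q.eval₂ (algebraMap S E) y) < 1)

include hSuc hinj hSO hdom hres in
/-- **One monoidal transform at `(x_a, x_b)` with `v(x_b) ≥ v(x_a)`** (both cases of
`MonoidalTransformFrameStep.lean` together): the model `S[insert (x_b/x_a) t]` lies in `O`, its
local ring is regular, and it has generators `x′` of the maximal ideal with `x′_c = x_c` for
`c ≠ b`. [cite: CossartPiltant2008, proof of Prop. 8.1 (HAL p. 23)] -/
theorem exists_frameStep_le {d : ℕ} (hSdim : ringKrullDim S = d)
    (t : Set E) (ht : t.Finite) (hTO : (Algebra.adjoin S t).toSubring ≤ O.toSubring)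
    (hreg : IsRegularLocalRing (locAtCentre (Algebra.adjoin S t).toSubring O))
    (x : Fin d → locAtCentre (Algebra.adjoin S t).toSubring O)
    (hx : haveI := isLocalRing_locAtCentre hTO
      Ideal.span (Set.range x) = maximalIdeal _)
    (a b : Fin d) (hab : a ≠ b) (hle : O.valuation (x b : E) ≤ O.valuation (x a : E)) :
    ∃ (hT₁O : (Algebra.adjoin S (insert ((x b : E) / (x a : E)) t)).toSubring ≤ O.toSubring),
      IsRegularLocalRing
        (locAtCentre (Algebra.adjoin S (insert ((x b : E) / (x a : E)) t)).toSubring O) ∧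
      ∃ x' : Fin d → locAtCentre (Algebra.adjoin S (insert ((x b : E) / (x a : E)) t)).toSubring O,
        (∀ c, c ≠ b → (x' c : E) = (x c : E)) ∧
        (haveI := isLocalRing_locAtCentre hT₁O
         Ideal.span (Set.range x') = maximalIdeal _) := by
  have hxa : (x a : E) ≠ 0 :=
    coe_rsop_ne_zero_of_frame hSuc hinj O hSO hdom hres hSdim t ht hTO hreg x hx a
  have hva : O.valuation (x a : E) ≠ 0 := (Valuation.ne_zero_iff _).mpr hxa
  have hle1 : O.valuation ((x b : E) / (x a : E)) ≤ 1 := by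
    rw [map_div₀]
    exact div_le_one_of_le₀ hle zero_le
  rcases hle1.lt_or_eq with hlt | h1
  · obtain ⟨hT₁O, hreg₁, x', hx'c, -, hspan, -⟩ :=
      exists_frameStep_of_valuation_lt_one hSuc hinj O hSO hdom hres hSdim t ht hTO hreg x hx a b
        hab hlt
    exact ⟨hT₁O, hreg₁, x', hx'c, hspan⟩
  · obtain ⟨hT₁O, hreg₁, -, x', hx'c, hspan, -⟩ :=
      exists_frameStep_of_valuation_eq_one hSuc hinj O hSO hdom hres hSdim t ht hTO hreg x hx a b
        hab h1
    exact ⟨hT₁O, hreg₁, x', hx'c, hspan⟩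

include hSuc hinj hSO hdom hres in
/-- **Principalizing the maximal ideal by two monoidal transforms along `O`.** Let `R_t` be a
regular frame model of dimension `3` with regular parameters `x`, and let `x_a` have the least
value (`v(x_c) ≥ v(x_a)` for all `c`; in the descent `v(x_a) ≤ v(y)` for every `y ∈ 𝔪`, so
`x_a` is `K`-finite). With `{a, b, c} = {0, 1, 2}`, the model `S[t ∪ {x_b/x_a, x_c/x_a}]` lies in
`O`, its local ring `R'` is regular and contains `R_t`, and every element of `𝔪_{R_t}` is `x_a`
times an element of `R'` (`𝔪_{R_t} R' = (x_a)`); the new generators have denominator `x_a`.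
[cite: CossartPiltant2008, proof of Prop. 8.1 (HAL pp. 22–23)]
[cite: CossartPiltant2019, proof of Prop. 4.8 with Lemma 4.7 (arXiv v1: Prop. 4.6, p. 53)] -/
theorem exists_frameSteps_maximalIdeal_principal (hSdim : ringKrullDim S = (3 : ℕ))
    (t : Set E) (ht : t.Finite) (hTO : (Algebra.adjoin S t).toSubring ≤ O.toSubring)
    (hreg : IsRegularLocalRing (locAtCentre (Algebra.adjoin S t).toSubring O))
    (x : Fin 3 → locAtCentre (Algebra.adjoin S t).toSubring O)
    (hx : haveI := isLocalRing_locAtCentre hTO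
      Ideal.span (Set.range x) = maximalIdeal _)
    (a b c : Fin 3) (hab : a ≠ b) (hac : a ≠ c) (hbc : b ≠ c)
    (hmin : ∀ k, O.valuation (x k : E) ≤ O.valuation (x a : E)) :
    ∃ (_ : (Algebra.adjoin S (insert ((x c : E) / (x a : E))
        (insert ((x b : E) / (x a : E)) t))).toSubring ≤ O.toSubring),
      IsRegularLocalRing (locAtCentre (Algebra.adjoin S (insert ((x c : E) / (x a : E))
        (insert ((x b : E) / (x a : E)) t))).toSubring O) ∧
      locAtCentre (Algebra.adjoin S t).toSubring O ≤
        locAtCentre (Algebra.adjoin S (insert ((x c : E) / (x a : E))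
          (insert ((x b : E) / (x a : E)) t))).toSubring O ∧
      (∀ y ∈ locAtCentre (Algebra.adjoin S t).toSubring O, O.valuation y < 1 →
        ∃ y' ∈ locAtCentre (Algebra.adjoin S (insert ((x c : E) / (x a : E))
          (insert ((x b : E) / (x a : E)) t))).toSubring O, y = (x a : E) * y') ∧
      (∀ z ∈ ({(x b : E) / (x a : E), (x c : E) / (x a : E)} : Set E),
        (x a : E) * z ∈ locAtCentre (Algebra.adjoin S t).toSubring O) := by
  classical
  haveI := isLocalRing_locAtCentre hTO
  have hxa : (x a : E) ≠ 0 :=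
    coe_rsop_ne_zero_of_frame hSuc hinj O hSO hdom hres hSdim t ht hTO hreg x hx a
  -- step 1 at `(x_a, x_b)`
  obtain ⟨hT₁O, hreg₁, x₁, hx₁c, hspan₁⟩ :=
    exists_frameStep_le hSuc hinj O hSO hdom hres hSdim t ht hTO hreg x hx a b hab (hmin b)
  have ht₁ : (insert ((x b : E) / (x a : E)) t).Finite := ht.insert _
  -- step 2 at `(x_a, x_c)` in the new parameters (`x₁_a = x_a`, `x₁_c = x_c`)
  have hx₁a : (x₁ a : E) = (x a : E) := hx₁c a hab
  have hx₁cc : (x₁ c : E) = (x c : E) := hx₁c c (Ne.symm hbc)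
  have hle₂ : O.valuation (x₁ c : E) ≤ O.valuation (x₁ a : E) := by
    rw [hx₁a, hx₁cc]; exact hmin c
  obtain ⟨hT₂O, hreg₂, x₂, -, -⟩ :=
    exists_frameStep_le hSuc hinj O hSO hdom hres hSdim _ ht₁ hT₁O hreg₁ x₁ hspan₁ a c hac hle₂
  have heq : insert ((x₁ c : E) / (x₁ a : E)) (insert ((x b : E) / (x a : E)) t) =
      insert ((x c : E) / (x a : E)) (insert ((x b : E) / (x a : E)) t) := by
    rw [hx₁a, hx₁cc]
  rw [heq] at hT₂O hreg₂
  have hsub : locAtCentre (Algebra.adjoin S t).toSubring O ≤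
      locAtCentre (Algebra.adjoin S (insert ((x c : E) / (x a : E))
        (insert ((x b : E) / (x a : E)) t))).toSubring O :=
    locAtCentre_mono O (Algebra.adjoin_mono
      ((Set.subset_insert _ _).trans (Set.subset_insert _ _)))
  have hzb : (x b : E) / (x a : E) ∈ locAtCentre (Algebra.adjoin S (insert ((x c : E) / (x a : E))
      (insert ((x b : E) / (x a : E)) t))).toSubring O :=
    le_locAtCentre _ _ (Algebra.subset_adjoin (Set.mem_insert_of_mem _ (Set.mem_insert _ _)))
  have hzc : (x c : E) / (x a : E) ∈ locAtCentre (Algebra.adjoin S (insert ((x c : E) / (x a : E))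
      (insert ((x b : E) / (x a : E)) t))).toSubring O :=
    le_locAtCentre _ _ (Algebra.subset_adjoin (Set.mem_insert _ _))
  refine ⟨hT₂O, hreg₂, hsub, fun y hy hvy => ?_, ?_⟩
  · -- `y ∈ 𝔪_{R_t} = (x_a, x_b, x_c)` and `x_b = (x_b/x_a) x_a`, `x_c = (x_c/x_a) x_a`
    have hymem : (⟨y, hy⟩ : locAtCentre (Algebra.adjoin S t).toSubring O) ∈
        Ideal.span (Set.range x) := by
      rw [hx]; exact (mem_maximalIdeal_locAtCentre_iff hTO _).mpr hvy
    -- every `x k` is `x_a` times an element of the new local ring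
    have hxk : ∀ k, ∃ q ∈ locAtCentre (Algebra.adjoin S (insert ((x c : E) / (x a : E))
        (insert ((x b : E) / (x a : E)) t))).toSubring O, (x k : E) = (x a : E) * q := by
      intro k
      by_cases hka : k = a
      · subst hka; exact ⟨1, Subring.one_mem _, by rw [mul_one]⟩
      by_cases hkb : k = b
      · subst hkb; exact ⟨_, hzb, by rw [mul_div_cancel₀ _ hxa]⟩
      have hkc : k = c := by omega
      subst hkc; exact ⟨_, hzc, by rw [mul_div_cancel₀ _ hxa]⟩
    -- induction on the span
    have key : ∀ (w : locAtCentre (Algebra.adjoin S t).toSubring O),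
        w ∈ Ideal.span (Set.range x) → ∃ y' ∈ locAtCentre (Algebra.adjoin S
          (insert ((x c : E) / (x a : E)) (insert ((x b : E) / (x a : E)) t))).toSubring O,
          (w : E) = (x a : E) * y' := by
      intro w hw
      induction hw using Submodule.span_induction with
      | mem w hw =>
        obtain ⟨k, rfl⟩ := hw
        exact hxk k
      | zero => exact ⟨0, Subring.zero_mem _, by simp⟩
      | add w₁ w₂ _ _ ih₁ ih₂ =>
        obtain ⟨y₁, hy₁, h₁⟩ := ih₁
        obtain ⟨y₂, hy₂, h₂⟩ := ih₂
        exact ⟨y₁ + y₂, Subring.add_mem _ hy₁ hy₂, by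
          change ((w₁ : E) + (w₂ : E)) = _
          rw [h₁, h₂, mul_add]⟩
      | smul r w _ ih =>
        obtain ⟨y₁, hy₁, h₁⟩ := ih
        exact ⟨(r : E) * y₁, Subring.mul_mem _ (hsub r.2) hy₁, by
          change ((r : E) * (w : E)) = _
          rw [h₁]; ring⟩
    exact key ⟨y, hy⟩ hymem
  · intro z hz
    rcases hz with rfl | rfl
    · rw [mul_div_cancel₀ _ hxa]; exact (x b).2
    · rw [mul_div_cancel₀ _ hxa]; exact (x c).2

end Principalize

end Literature.AlgebraicGeometry.Resolution

end
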